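import Literature.MathematicalPhysics.QuantumFieldTheory.Balaban1983to89.B8Prop6DentedCubeMemberScalarGammaRec
import Literature.MathematicalPhysics.QuantumFieldTheory.Balaban1983to89.B8Real123CubeMemberRec
import Literature.MathematicalPhysics.QuantumFieldTheory.Balaban1983to89.B8Ineq159FlatDentedCubeMemberSCGammaRec

/-!
# `Balaban1983to89.B8Prop6DentedCubeMemberScalarGammaOfNamedFactsRec` — RECORD TWIN of `B8Prop6DentedCubeMemberScalarGammaOfNamedFacts` §1–§2 + THE RECORD CROWN
# MODULO TWO PRINTED NAMED FACTS: [Balaban1985RegularSpaces] PROPOSITION 6 (p. 99) AS `Node00.GaugedBoundB8DZ` AT EVERY DENTED CENTRED CUBE MEMBER OF PRINT's BIG-BLOCK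
# SUB-LATTICE (symmetrised centred averaging (0.4) of [Balaban1987RG1]) — item R6 (g)-7∕(g)-8 of the record crown (desk `R6-PLAN.md` §5; bus FINDING-1)

statement-level skeleton of published theorems with citation tags; proofs where landed; nothing here is a claim about the Yang–Mills mass gap

T. Bałaban, *Spaces of regular gauge field configurations on a lattice and gauge fixing conditions*, Commun. Math. Phys. **99** (1985) 75–102 `[Balaban1985RegularSpaces]`
("[6]"): Prop. 6 (1.135)–(1.138) p. 99, p. 98, Thm 4 p. 88, Prop. 3 p. 87, Prop. 5 p. 93, (1.55)–(1.62) pp. 86–87, (1.31) p. 82, (1.91)–(1.92) p. 91, (1.98) p. 92, (1.101) p. 93,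
(1.4) p. 77; T. Bałaban, *The variational problem and background fields in renormalization group method for lattice gauge theories*, Commun. Math. Phys. **102** (1985)
277–309 `[Balaban1985Variational]` ("[15]"): (148)–(153) p. 301, p. 300; T. Bałaban, *Propagators for lattice gauge theories in a background field*, Commun. Math. Phys. **99**
(1985) 389–434 `[Balaban1985BackgroundPropagators]` ("[4]"): (3.13) p. 392, (3.14)–(3.16) p. 393, Thms 3.1–3.3 pp. 398–399; T. Bałaban, *Propagators and renormalization
transformations for lattice gauge theories. II*, Commun. Math. Phys. **96** (1984) 223–250 `[Balaban1984PropagatorsII]` ("[B6]"): Prop. 2.6 (2.136) p. 247, Prop. 2.3 (2.87)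
p. 238, (2.3) p. 224; T. Bałaban, *Renormalization group approach to lattice gauge field theories. I*, Commun. Math. Phys. **109** (1987) 249–301 `[Balaban1987RG1]` ("[I]"):
(0.3)–(0.4) pp. 252–253.  STATUS: published, refereed.

CITATION HEADER (lean-in-tree rule).  Cell `pub-ymgap`, «N05-REC» stage 2 (director-ym №254∕№255∕№288), items R6 (g)-7∕(g)-8 — typed by the LEAD PEN dag-n05-e g39 (inventory
`N05-REC-INVENTORY.md` §R6 rows `B8Prop6DentedCubeMemberScalarGammaOfNamedFacts` ∕ `…Holds`).  WHAT IS REPRODUCED.  §1 = ✓ the engine's §1 (seat `pub-ymgap-dag-n05-e` g31)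
under the token map of (g)-4∕(g)-6 WITH ITS NAMED REAL HYPOTHESIS DISCHARGED: the three REAL families ((1.91)–(1.92), (1.101), (1.98) at `U = 1`) at every truncation of the
dented RECORD member are dag-n05-e g38's UNCONDITIONAL `B8Real123CubeMemberRec.prop6_real123_printedZ` (below the top: the truncated dented tower IS the pure member's,
`CubeB8DZ.sq_of_lt`, `lamST_of_lt`) and `B8Real123CubeMemberRec.real123DentedCubeMemberPrintedZ_holds` (the top) — so §1 displays ONLY the two scalar flat (1.59) γ clauses
(record Landau gauge `IsLandau138Z`, record averaging datum `linCovIterZ L 1`).  §2 = ✓ the engine's §2: the scalar clauses from the two flat named facts OF RECORD through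
(f) `B8Ineq159FlatDentedCubeMemberSCGammaRec.sc4_dented_of_ineq159Printed` — CONDITIONAL on `B8Ineq159FlatCovPrintedRec.Ineq159FlatCubeMemberCovPrintedZ d L` and
`Ineq159FlatDentedCubeMemberCovPrintedZ d L` ([4] Thm 3.3 ∕ [6] (1.59), (1.62) at `U₀ = 1` FOR THE RECORD OPERATOR `Q_j(1)` = [4] (3.14)–(3.15), the linear part of [3]'s
averaging; NAMED, NOT proved — bus FINDING-1: dag-n05-e g38's PROVED straight-datum facts are the simple averaging's (1.59) re-centred and do not serve).  §3 = THE RECORD CROWN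
`gaugedBoundB8DZ_dentedMember_of_cov159`: §2 at odd `L = 2s+1 ≥ 5`, `d ≥ 2` (the window `5 ≤ d·L` discharged) — Proposition 6's conclusion `GaugedBoundB8DZ` (∃ a unitary `u` on `□̃`,
`= 1` off `Ω′₀`, (1.29), the Landau gauge (1.138) of `U₀″^{u⁻¹}`, (1.136)₁–₄ with print's constant shape `7dL²·(5dLB₀)·M·α₀`, `w = v⁻¹u` unitary, (1.135), (1.137)) at every
dented RECORD cube datum of print's p. 98 big-block sub-lattice whose `Ω_k` satisfies the anchored dent premise, for every unitary `U₀ ∈ 𝔄_K({Ω_j}, α₀)` with `7dL²Mα₀ ≤ c₁`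
— MODULO EXACTLY THE TWO PRINTED NAMED FACTS ABOVE, and nothing else.  The engine's §3 (pure flat fact discharged by the torus transplant) has NO record counterpart: the
transplant proves the straight-datum fact only.  THEOREM NAMES = the engine's (namespace `…OfNamedFactsRec`) + the crown's.  Kind «kernel-checked proof», theorems only;
no `def`, no `instance`, no `notation`, no existing module modified.  `--supports stmt-QuantumFields-20541` (K0⁷-keyed, COUNT-NEUTRAL).

HONEST SCOPE: §1 unconditional in REAL (the scalar (1.59) clauses displayed); §2, §3 CONDITIONAL on the two named facts of record ([4] Thm 3.3 for the record operator — OWED: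
[4] Sect. C pp. 408–416 for the constraint operators «straight block average + coarse gradient of the carried letter»; no held source shortcuts it, lit-balaban desk I.29198 ∕
I.29202).  Nothing of [3]∕[4]∕[6]∕[15]∕[B6]∕[I] newly proved; `HThm4Rec` UNDISCHARGED; N05 [B8] DISCHARGED OF RECORD untouched (simple averaging); N05 ∕ N07 NOT discharged;
COUNT of record unmoved · K numerically unchanged; one finite `𝕋⁴` programme at fixed `ε`, Bałaban AS PRINTED; nothing continuum ∕ ℝ⁴ ∕ OS ∕ mass-gap ∕ Clay.  No `sorry`,
no `def`.

[cite: Balaban1985RegularSpaces, Prop. 6 (1.135)–(1.138) p.99, p.98, Theorem 4 p.88, Prop. 3 p.87, Prop. 5 p.93, (1.59) p.86, (1.62) p.87, (1.31) p.82, (1.91)–(1.92) p.91,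
(1.98) p.92, (1.101) p.93, (1.4) p.77; Balaban1985Variational, (148)–(153) p.301, p.300; Balaban1985BackgroundPropagators, (3.13) p.392, (3.14)–(3.15) p.393, Theorems 3.1–3.3
pp.398–399; Balaban1984PropagatorsII, Prop. 2.6 (2.136) p.247, Prop. 2.3 (2.87) p.238, (2.3) p.224; Balaban1987RG1, (0.3)–(0.4) pp.252–253]
-/

noncomputable section

open NormedSpace
open scoped BigOperators

namespace Literature.MathematicalPhysics.QuantumFieldTheory.Balaban1983to89.B8Prop6DentedCubeMemberScalarGammaOfNamedFactsRec

open scoped Matrix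
open MatrixLog B7Prop1Explicit B7Prop2Explicit B7Prop1Local B7Eq92Concrete
open BlockAveragingZd (ctrShift)
open B7Prop4GeneralLevelsRec (cZ gZ KZ gZ_nonneg)
open B7SectEFLinearisationRec (linCovIterZ)
open B8Ineq132 (covDerivFwd InAk BondTouches)
open B8Eq140Level (SideTouches)
open B8Eq143PlaqExpansion (pdiv)
open B8Eq146AExpansion (iEta plaqCovDeriv)
open B8Eq155JBound (Jcur wsup)
open B8ScaledSupNorm (bondNorm msup)
open B8Eq138LandauZd (covLap)
open B8Eq138LandauZdRec (IsLandau138Z)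
open B8LambdaSpaceKLevel (wt)
open B8Eq131CubesAdmissibleRec (cubeFamZ cubeFam_false_of_le)
open B8Eq119TwistedAxialRec (flmZ)
open B8Eq1101CubeMemberWeights (wPrinted wPrinted_facts)
open B8Real123FlatTranslateRec (Real123Block)
open B8Real123CubeMemberRec (prop6_real123_printedZ Real123DentedCubeMemberPrintedZ real123DentedCubeMemberPrintedZ_holds)
open B8Ineq159FlatCovPrintedRec (Ineq159FlatCubeMemberCovPrintedZ Ineq159FlatDentedCubeMemberCovPrintedZ)
open B8Ineq159FlatDentedCubeMemberSCGammaRec (lamBPF_sub_splitIndex sc4_dented_of_ineq159Printed)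
open B8DentedCubeMemberZdRec (lamST_of_lt lamST_top_apply)
open B8Prop6DentedCubeMemberScalarGammaRec (gaugedBoundB8D_dentedMember_scalar_γ)
open B9SupplySockB9P3ZdBeta (CrossB)
open Node00 (CubeB8DZ GaugedBoundB8DZ)
open Literature.MathematicalPhysics.QuantumLattice (blockMap)

export B7Prop1Explicit (Site)

variable {d : ℕ}

variable {𝔸 : Type} [CStarAlgebra 𝔸] [Nontrivial 𝔸]

/-! ## §1 `GaugedBoundB8D` at a dented member of the sub-lattice from the scalar γ clauses, the REAL families FED (pure below the top, named at the top) -/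

open Classical in
/-- ★ **PROPOSITION 6 (p. 99), (1.135)–(1.138) AS `Node00.GaugedBoundB8D` AT A DENTED CUBE MEMBER OF PRINT's BIG-BLOCK SUB-LATTICE, FROM THE TWO SCALAR FLAT γ
CLAUSES — THE THREE REAL FAMILIES FED BY NAME** — (d3)-11's `gaugedBoundB8D_dentedMember_scalar_γ` with its weights instantiated at print's `wPrinted (d−1) (L−1) η` and its
three REAL inequality families at every truncation `1 ≤ n ≤ k` DISCHARGED: for `n < k` the truncated dented tower `(c.sq ↾ n, c.lamST n)` IS the pure member's
(`CubeB8D.sq_of_lt`, `lamST_of_lt`), and dag-n05-c's UNCONDITIONAL `B8Thm32GBoundCubeMemberHolds.prop6_real123_printed` ((1.91)–(1.92), (1.101), (1.98) on the pure member)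
serves letter by letter; for `n = k` the named `Real123DentedCubeMemberPrinted (d−1) (L−1)` (OPEN; [4] Thms 3.1–3.2 on [15]'s `{Ω′_j}`).  Print's p. 98 side conditions on
the datum (`M_h ≥ 3`, `M₀ ≤ L·M_h`, `M_hL ∣ c.ρ`, `M_hL ∣ c.M`, `R·M_hL ≤ c.ρ`, `2L ≤ R`, `N₀ + 1 ≤ R·L·M_h`, `ρ₀ ≤ c.ρ`) and the dent premise displayed; constants = maxima of
the two sources.  CONDITIONAL on `hR` and on the displayed scalar clauses.
[cite: Balaban1985RegularSpaces, Prop. 6 (1.135)–(1.138) p.99, p.98, Thm 4 p.88, Prop. 3 p.87, (1.59) p.86, (1.31) p.82, (1.91)–(1.92) p.91, (1.98) p.92, (1.101) p.93; Balaban1985Variational, (148)–(152) p.301; Balaban1985BackgroundPropagators, Thm 3.2 (3.48) p.398, Thm 3.1 (3.47) p.398, Thm 3.3 p.399] -/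
theorem gaugedBoundB8D_dentedMember_scalar_γ_of_real123 (hd2 : 2 ≤ d) {L sL : ℕ} (hLs : L = 2 * sL + 1) (hs1 : 1 ≤ sL) {B₀ Bbd : ℝ} (hB₀ : 0 < B₀)
    (hB : 2 ≤ 5 * (d : ℝ) * L * B₀) (hBbd : 0 ≤ Bbd) (hBd : 4 * Bbd ≤ ((d : ℝ) * L - 1) * B₀) :
    ∃ c₁ ρ₀ M₀ : ℝ, ∃ N₀ : ℕ, 0 < c₁ ∧ ∀ (η : ℝ), 0 < η → ∀ {K : ℕ} {Ω : ℕ → Set (Site d)} (c : CubeB8DZ d L K Ω),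
      -- PRINT'S SIDE CONDITIONS (p. 98) on the cube datum, above threshold: big blocks `M_hL`, `ρ ≥ R·M_hL`, `M_hL ∣ ρ`, `M_hL ∣ M`
      ∀ (Mh R : ℕ), 3 ≤ Mh → M₀ ≤ (L : ℝ) * Mh → Mh * L ∣ c.ρ → Mh * L ∣ c.M → R * (Mh * L) ≤ c.ρ → 2 * L ≤ R →
        N₀ + 1 ≤ R * (L * Mh) → ρ₀ ≤ (c.ρ : ℝ) →
      -- THE DENT PREMISE ([6] (1.4)₂): `Ω_k` is a union of cubes of side `M_hL^{k+1}` of the grid anchored at `□_k`'s fine lower corner `Lᵏ(c.a − c.ρ)`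
      (∀ x y : Site d,
          blockMap (Mh * L ^ (c.k + 1)) (x - fun i => (L : ℤ) ^ c.k * (c.a i - c.ρ) - (ctrShift L c.k : ℤ)) =
            blockMap (Mh * L ^ (c.k + 1)) (y - fun i => (L : ℤ) ^ c.k * (c.a i - c.ρ) - (ctrShift L c.k : ℤ)) → x ∈ Ω c.k → y ∈ Ω c.k) →
      -- THE SCALAR FLAT FOUR-LINE (1.59) CLAUSE OF PROPOSITION 3's FRAME at the cube's top truncation `c.k`: ℂ-valued bond functions in the
      -- flat Landau gauge on the collars of `{□_j}`, exterior-collar allowance on each line ([4] Thm 3.3 at `U = 1` for `G(1)`, `H(1)`, a priori)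
      (∀ φ : Site d → Fin d → ℂ,
        IsLandau138Z L c.k η (c.sq 0) c.lamS (1 : Site d → Fin d → ℂˣ) φ →
        (∀ (y : Site d) (τ : Fin d), (∀ j, j ≤ c.k → ¬ SideTouches (c.sq j) y τ) → φ y τ = 0) →
        msup L c.k η (-(1 : ℝ)) (fun j (b : Site d × Fin d) => SideTouches (c.sq j) b.1 b.2) (fun b => φ b.1 b.2)
          ≤ B₀ * (bondNorm L c.k η (-(3 : ℝ)) c.sq (fun x μ => Jcur η (1 : Site d → Fin d → ℂˣ) φ μ x)
            + wsup 1 (fun p : {p : ℕ × (Site d × Fin d) // p.1 ≤ c.k ∧ (p.2 ∈ c.lamBPT c.k p.1 ∨ (p.1 = 0 ∧ CrossB (c.sq 0) p.2))} =>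
                linCovIterZ L (1 : Site d → Fin d → ℂˣ) (iEta η φ) p.1.1 p.1.2.1 p.1.2.2))
            + Bbd * msup L c.k η (-(1 : ℝ)) (fun j (b : Site d × Fin d) => j = 0 ∧ SideTouches (c.sq 0) b.1 b.2 ∧
                ¬ BondTouches (c.sq 0) b.1 b.2) (fun b => φ b.1 b.2) ∧
        msup L c.k η (-(2 : ℝ)) (fun j (t : Fin d × Fin d × Site d) => SideTouches (c.sq j) t.2.2 t.2.1)
            (fun t => covDerivFwd η (1 : Site d → Fin d → ℂˣ) t.1 (fun z => φ z t.2.1) t.2.2)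
          ≤ B₀ * (bondNorm L c.k η (-(3 : ℝ)) c.sq (fun x μ => Jcur η (1 : Site d → Fin d → ℂˣ) φ μ x)
            + wsup 1 (fun p : {p : ℕ × (Site d × Fin d) // p.1 ≤ c.k ∧ (p.2 ∈ c.lamBPT c.k p.1 ∨ (p.1 = 0 ∧ CrossB (c.sq 0) p.2))} =>
                linCovIterZ L (1 : Site d → Fin d → ℂˣ) (iEta η φ) p.1.1 p.1.2.1 p.1.2.2))
            + Bbd * msup L c.k η (-(1 : ℝ)) (fun j (b : Site d × Fin d) => j = 0 ∧ SideTouches (c.sq 0) b.1 b.2 ∧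
                ¬ BondTouches (c.sq 0) b.1 b.2) (fun b => φ b.1 b.2) ∧
        bondNorm L c.k η (-(3 : ℝ)) c.sq (fun x μ => pdiv η (1 : Site d → Fin d → ℂˣ) (plaqCovDeriv η (1 : Site d → Fin d → ℂˣ) φ) μ x)
          ≤ B₀ * (bondNorm L c.k η (-(3 : ℝ)) c.sq (fun x μ => Jcur η (1 : Site d → Fin d → ℂˣ) φ μ x)
            + wsup 1 (fun p : {p : ℕ × (Site d × Fin d) // p.1 ≤ c.k ∧ (p.2 ∈ c.lamBPT c.k p.1 ∨ (p.1 = 0 ∧ CrossB (c.sq 0) p.2))} =>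
                linCovIterZ L (1 : Site d → Fin d → ℂˣ) (iEta η φ) p.1.1 p.1.2.1 p.1.2.2))
            + Bbd * msup L c.k η (-(1 : ℝ)) (fun j (b : Site d × Fin d) => j = 0 ∧ SideTouches (c.sq 0) b.1 b.2 ∧
                ¬ BondTouches (c.sq 0) b.1 b.2) (fun b => φ b.1 b.2) ∧
        bondNorm L c.k η (-(3 : ℝ)) c.sq (fun x μ => covLap η (1 : Site d → Fin d → ℂˣ) (fun z => φ z μ) x)
          ≤ B₀ * (bondNorm L c.k η (-(3 : ℝ)) c.sq (fun x μ => Jcur η (1 : Site d → Fin d → ℂˣ) φ μ x)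
            + wsup 1 (fun p : {p : ℕ × (Site d × Fin d) // p.1 ≤ c.k ∧ (p.2 ∈ c.lamBPT c.k p.1 ∨ (p.1 = 0 ∧ CrossB (c.sq 0) p.2))} =>
                linCovIterZ L (1 : Site d → Fin d → ℂˣ) (iEta η φ) p.1.1 p.1.2.1 p.1.2.2))
            + Bbd * msup L c.k η (-(1 : ℝ)) (fun j (b : Site d × Fin d) => j = 0 ∧ SideTouches (c.sq 0) b.1 b.2 ∧
                ¬ BondTouches (c.sq 0) b.1 b.2) (fun b => φ b.1 b.2)) →
      ∀ (U₀ : Site d → Fin d → 𝔸ˣ), (∀ x κ, U₀ x κ ∈ unitaryUnits 𝔸) → ∀ (α₀ : ℝ), 0 < α₀ → InAk L K η α₀ Ω U₀ →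
      7 * d * (L : ℝ) ^ 2 * c.M * α₀ ≤ c₁ →
      -- THE SCALAR FLAT TWO-LINE (1.59) CLAUSE OF THEOREM 4's FRAME at every truncation `m ≤ c.k` (ℂ-valued, flat Landau gauge, collar allowance)
      (∀ m, 1 ≤ m → m ≤ c.k → ∀ φ : Site d → Fin d → ℂ,
        IsLandau138Z L m η (c.sq 0) (c.lamST m) (1 : Site d → Fin d → ℂˣ) φ →
        (∀ (y : Site d) (τ : Fin d), (∀ j, j ≤ m → ¬ SideTouches (c.sq j) y τ) → φ y τ = 0) →
        msup L m η (-(1 : ℝ)) (fun j (b : Site d × Fin d) => SideTouches (c.sq j) b.1 b.2) (fun b => φ b.1 b.2)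
          ≤ B₀ * (bondNorm L m η (-(3 : ℝ)) c.sq (fun x μ => Jcur η (1 : Site d → Fin d → ℂˣ) φ μ x)
            + wsup 1 (fun p : {p : ℕ × (Site d × Fin d) // p.1 ≤ m ∧ (p.2 ∈ c.lamBPT m p.1 ∨ (p.1 = 0 ∧ CrossB (c.sq 0) p.2))} =>
                linCovIterZ L (1 : Site d → Fin d → ℂˣ) (iEta η φ) p.1.1 p.1.2.1 p.1.2.2))
            + Bbd * msup L m η (-(1 : ℝ)) (fun j (b : Site d × Fin d) => j = 0 ∧ SideTouches (c.sq 0) b.1 b.2 ∧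
                ¬ BondTouches (c.sq 0) b.1 b.2) (fun b => φ b.1 b.2) ∧
        msup L m η (-(2 : ℝ)) (fun j (t : Fin d × Fin d × Site d) => SideTouches (c.sq j) t.2.2 t.2.1)
            (fun t => covDerivFwd η (1 : Site d → Fin d → ℂˣ) t.1 (fun z => φ z t.2.1) t.2.2)
          ≤ B₀ * (bondNorm L m η (-(3 : ℝ)) c.sq (fun x μ => Jcur η (1 : Site d → Fin d → ℂˣ) φ μ x)
            + wsup 1 (fun p : {p : ℕ × (Site d × Fin d) // p.1 ≤ m ∧ (p.2 ∈ c.lamBPT m p.1 ∨ (p.1 = 0 ∧ CrossB (c.sq 0) p.2))} =>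
                linCovIterZ L (1 : Site d → Fin d → ℂˣ) (iEta η φ) p.1.1 p.1.2.1 p.1.2.2))
            + Bbd * msup L m η (-(1 : ℝ)) (fun j (b : Site d × Fin d) => j = 0 ∧ SideTouches (c.sq 0) b.1 b.2 ∧
                ¬ BondTouches (c.sq 0) b.1 b.2) (fun b => φ b.1 b.2)) →
      GaugedBoundB8DZ L η U₀ c (7 * d * (L : ℝ) ^ 2 * (5 * (d : ℝ) * L * B₀) * c.M * α₀) := by
  -- write `d = d' + 1`, `L = ℓ + 1` (dag-n05-c's convention)
  obtain ⟨d', rfl⟩ : ∃ d', d = d' + 1 := ⟨d - 1, by omega⟩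
  obtain ⟨ℓ, rfl⟩ : ∃ ℓ, L = ℓ + 1 := ⟨L - 1, by omega⟩
  have hℓ : 1 ≤ ℓ := by omega
  have hodd : Odd (ℓ + 1) := ⟨sL, by omega⟩
  -- the PURE real families (dag-n05-c, unconditional) and the DENTED ones at the top (named)
  obtain ⟨BGp, BHp, B2p, BRp, ρ₁, M₁, N₁, hBGp, hBHp, hB2p, hBRp, -, -, RP⟩ := prop6_real123_printedZ d' ℓ hℓ hodd
  have hR' : Real123DentedCubeMemberPrintedZ d' ℓ := real123DentedCubeMemberPrintedZ_holds d' ℓ hℓ hodd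
  obtain ⟨BGd, BHd, B2d, BRd, ρ₂, M₂, N₂, -, -, -, -, RD⟩ := hR'
  -- (d3)-11's constants: maxima of the two sources
  have hBG : 0 < max BGp BGd := lt_max_of_lt_left hBGp
  have hBH : 0 < max BHp BHd := lt_max_of_lt_left hBHp
  have hB2 : 0 ≤ max B2p B2d := le_max_of_le_left hB2p
  have hBR : 0 ≤ max BRp BRd := le_max_of_le_left hBRp
  have hB₀' : 0 < 3 * (2 * ((d' + 1 : ℕ) : ℝ) * (((ℓ + 1 : ℕ) : ℝ)) ^ 2) * max BGp BGd * max BRp BRd + 1 := by positivity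
  have hfree : 3 * (2 * ((d' + 1 : ℕ) : ℝ) * (((ℓ + 1 : ℕ) : ℝ)) ^ 2) * max BGp BGd * max BRp BRd ≤
      3 * (2 * ((d' + 1 : ℕ) : ℝ) * (((ℓ + 1 : ℕ) : ℝ)) ^ 2) * max BGp BGd * max BRp BRd + 1 := by linarith
  have hC₂ : 2 * ((1 + 2 * gZ (d' + 1) (ℓ + 1)) * (2 * (131072 * (((d' + 1 : ℕ) : ℝ) + 1) ^ 2) * (KZ (d' + 1) (ℓ + 1)) ^ 2)) * (((ℓ + 1 : ℕ) : ℝ)) ^ 2 ≤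
      2 * ((1 + 2 * gZ (d' + 1) (ℓ + 1)) * (2 * (131072 * (((d' + 1 : ℕ) : ℝ) + 1) ^ 2) * (KZ (d' + 1) (ℓ + 1)) ^ 2)) * (((ℓ + 1 : ℕ) : ℝ)) ^ 2 :=
    le_rfl
  obtain ⟨c₁, hc₁, G⟩ := gaugedBoundB8D_dentedMember_scalar_γ (𝔸 := 𝔸) hd2 hLs hs1 hB₀ hB₀' hB hC₂ hBH hB2 hBG.le hBR hfree hBbd hBd
  refine ⟨c₁, max ρ₁ ρ₂, max M₁ M₂, max N₁ N₂, hc₁, ?_⟩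
  intro η hη K Ω c Mh R hMh hM0 hρd hMd hRρ hR2 hRN hρ0 hΩ SC4 U₀ hU₀ α₀ hα hAK hs SC2
  refine G η hη c SC4 U₀ hU₀ α₀ hα hAK hs (wPrinted d' ℓ η) (fun j => ((wPrinted_facts d' hℓ hη).1 j).le) ?_ SC2
  -- the REAL block of (d3)-11 at `w := wPrinted`
  intro n hn hnk
  unfold Real123Block
  intro S hS B hB Kf hKf T hT Q hQ
  have hρpos : 0 < c.ρ := lt_of_lt_of_le (by omega) c.L_le_ρ
  have hM0' : max M₁ M₂ ≤ ((ℓ : ℝ) + 1) * Mh := by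
    have : ((ℓ + 1 : ℕ) : ℝ) = (ℓ : ℝ) + 1 := by push_cast; ring
    rw [← this]; exact hM0
  have hM₁ : M₁ ≤ ((ℓ : ℝ) + 1) * Mh := (le_max_left _ _).trans hM0'
  have hM₂ : M₂ ≤ ((ℓ : ℝ) + 1) * Mh := (le_max_right _ _).trans hM0'
  have hN₁ : N₁ + 1 ≤ R * ((ℓ + 1) * Mh) := le_trans (Nat.succ_le_succ (le_max_left _ _)) hRN
  have hN₂ : N₂ + 1 ≤ R * ((ℓ + 1) * Mh) := le_trans (Nat.succ_le_succ (le_max_right _ _)) hRN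
  have hρ₁ : ρ₁ ≤ (c.ρ : ℝ) := (le_max_left _ _).trans hρ0
  have hρ₂ : ρ₂ ≤ (c.ρ : ℝ) := (le_max_right _ _).trans hρ0
  rcases lt_or_eq_of_le hnk with hlt | heq
  · -- `n < k`: the truncated dented tower is the PURE member's — dag-n05-c's theorem, letter by letter
    have hsqj : ∀ j, j ≤ n → c.sq j = cubeFamZ false (ℓ + 1) c.a c.M c.ρ c.k j := fun j hj => by
      rw [c.sq_of_lt (lt_of_le_of_lt hj hlt), cubeFam_false_of_le (ℓ + 1) c.a c.M c.ρ (hj.trans hnk)]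
    have hsq0 := hsqj 0 (Nat.zero_le n)
    rw [hsq0] at hS
    rw [lamST_of_lt c hlt] at hB hKf
    obtain ⟨P1, P2, P3⟩ := RP η hη Mh hMh hM₁ c.a c.M c.ρ c.k n R hn hnk hρd hMd hρpos hRρ hR2 hN₁ hρ₁ S hS B hB Kf hKf T hT Q hQ
    refine ⟨fun ρ' r hr hρ' φ hφ0 hφS => ?_, fun X s hs0 hXs φ hφ0 hφS => ?_, fun ρ' r hr hρ' j hj v hv => ?_⟩
    · obtain ⟨a1, a2⟩ := P1 ρ' r hr (fun j hj z hz => hρ' j hj z (by rw [hsqj j hj]; exact hz)) φ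
        (fun x hx => hφ0 x (by rw [hsq0]; exact hx)) hφS
      exact ⟨fun x => (a1 x).trans (mul_le_mul_of_nonneg_right (le_max_left _ _) hr),
        fun j hj p hp => (a2 j hj p (by rw [← hsqj j hj]; exact hp)).trans (mul_le_mul_of_nonneg_right (le_max_left _ _) hr)⟩
    · obtain ⟨f, g, Δ⟩ := P2 X s hs0 hXs φ (fun x hx => hφ0 x (by rw [hsq0]; exact hx)) hφS
      exact ⟨fun x => (f x).trans (mul_le_mul_of_nonneg_right (le_max_left _ _) hs0),
        fun j hj p hp => (g j hj p (by rw [← hsqj j hj]; exact hp)).trans (mul_le_mul_of_nonneg_right (le_max_left _ _) hs0),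
        fun j hj x hx => (Δ j hj x (by rw [← hsqj j hj]; exact hx)).trans (mul_le_mul_of_nonneg_right (le_max_left _ _) hs0)⟩
    · exact (P3 ρ' r hr (fun j' hj' z hz => hρ' j' hj' z (by rw [hsqj j' hj']; exact hz)) j hj v
        (by rw [← hsqj j hj]; exact hv)).trans (mul_le_mul_of_nonneg_right (le_max_left _ _) hr)
  · -- `n = k`: the DENTED named fact verbatim (cells `c.lamS = c.lamST c.k`)
    subst heq
    have hTop : c.lamST c.k = c.lamS := funext (lamST_top_apply c)
    rw [hTop] at hB hKf
    obtain ⟨P1, P2, P3⟩ := RD η hη Mh hMh hM₂ _ _ c R hρd hMd hRρ hR2 hN₂ hρ₂ hΩ S hS B hB Kf hKf T hT Q hQ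
    refine ⟨fun ρ' r hr hρ' φ hφ0 hφS => ?_, fun X s hs0 hXs φ hφ0 hφS => ?_, fun ρ' r hr hρ' j hj v hv => ?_⟩
    · obtain ⟨a1, a2⟩ := P1 ρ' r hr hρ' φ hφ0 hφS
      exact ⟨fun x => (a1 x).trans (mul_le_mul_of_nonneg_right (le_max_right _ _) hr),
        fun j hj p hp => (a2 j hj p hp).trans (mul_le_mul_of_nonneg_right (le_max_right _ _) hr)⟩
    · obtain ⟨f, g, Δ⟩ := P2 X s hs0 hXs φ hφ0 hφS
      exact ⟨fun x => (f x).trans (mul_le_mul_of_nonneg_right (le_max_right _ _) hs0),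
        fun j hj p hp => (g j hj p hp).trans (mul_le_mul_of_nonneg_right (le_max_right _ _) hs0),
        fun j hj x hx => (Δ j hj x hx).trans (mul_le_mul_of_nonneg_right (le_max_right _ _) hs0)⟩
    · exact (P3 ρ' r hr hρ' j hj v hv).trans (mul_le_mul_of_nonneg_right (le_max_right _ _) hr)

/-! ## §2 The crown: `GaugedBoundB8D` at a dented member of the sub-lattice from the THREE NAMED FACTS -/

open Classical in
/-- ★★ **PROPOSITION 6 (p. 99), (1.135)–(1.138) AS `Node00.GaugedBoundB8D` AT EVERY DENTED CUBE MEMBER OF PRINT's BIG-BLOCK SUB-LATTICE, FROM THE NAMED FLAT FACTS.**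
There are `B₀ ≥ 1`, `c₁ > 0` and thresholds `ρ₀, M₀, N₀, R₀` such that for every `η > 0`, every dented cube datum `c : CubeB8D d L K Ω` ([15] (148)–(150)) on print's
p. 98 sub-lattice above threshold (`M_h = Lˢ ≥ 3`, `M₀ ≤ L^{s+1}`, `L^{s+1} ∣ ρ`, `L^{s+1} ∣ M`, `R·L^{s+1} ≤ ρ`, `2L ≤ R`, `R₀ ≤ R`, `N₀ + 1 ≤ R·L^{s+1}`, `ρ₀ ≤ ρ`) whose
ambient top member `Ω_k` is a union of `L^{s+1}Lᵏ`-cubes of the grid anchored at `□_k`'s corner ((1.4)₂), every unitary `U₀ ∈ 𝔄_K({Ω_j}, α₀)` with `7dL²Mα₀ ≤ c₁`: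
`GaugedBoundB8D L η U₀ c (7dL²·5dLB₀·Mα₀)` — Proposition 6's gauge `u` on `□̃`, the Landau gauge (1.138) at background `1` over the dented tower `{Ω′_j}`, (1.136)₁–₄
with print's constant shape.  HYPOTHESES (three named facts): the pure `h159 : Ineq159FlatCubeMemberPrinted d L` ((1.59) at `U₀ = 1` on the pure member — PROVED in the
tree for odd `L ≥ 5`, see §3), the dented `h159D : Ineq159FlatDentedCubeMemberPrinted d L` (top truncation of `{Ω′_j}`; OPEN) and `hR : Real123DentedCubeMemberPrinted
(d−1) (L−1)` ((1.91)–(1.92), (1.98), (1.101) at the top truncation of `{Ω′_j}`; OPEN); window `5 ≤ d·L`.  Composition: `sc4_dented_of_ineq159Printed` at the datum with the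
flat line's split index (`lamBPF_sub_splitIndex`; SC4γ at `m = k`, the first two lines at every `1 ≤ m ≤ k`) into §1 at `M_h := Lˢ`.
[cite: Balaban1985RegularSpaces, Prop. 6 (1.135)–(1.138) p.99, p.98, Thm 4 p.88, Prop. 3 p.87, (1.59) p.86, (1.62) p.87, (1.31) p.82, (1.91)–(1.92) p.91, (1.98) p.92, (1.101) p.93, (1.4) p.77; Balaban1985Variational, (148)–(152) p.301, p.300; Balaban1985BackgroundPropagators, Thm 3.3 p.399, Thm 3.2 (3.48) p.398, Thm 3.1 (3.47) p.398; Balaban1984PropagatorsII, Prop. 2.6 (2.136) p.247, Prop. 2.3 (2.87) p.238] -/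
theorem gaugedBoundB8D_dentedMember_scalar_γ_of_namedFacts (hd2 : 2 ≤ d) {L sL : ℕ} (hLs : L = 2 * sL + 1) (hs1 : 1 ≤ sL) (hdL : 5 ≤ d * L)
    (h159 : Ineq159FlatCubeMemberCovPrintedZ d L) (h159D : Ineq159FlatDentedCubeMemberCovPrintedZ d L) :
    ∃ B₀ c₁ ρ₀ M₀ : ℝ, ∃ N₀ R₀ : ℕ, 1 ≤ B₀ ∧ 0 < c₁ ∧ ∀ (η : ℝ), 0 < η → ∀ {K : ℕ} {Ω : ℕ → Set (Site d)} (c : CubeB8DZ d L K Ω),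
      -- PRINT'S SIDE CONDITIONS (p. 98) on the cube datum in the named facts' letters (`M_h = Lˢ`), above threshold
      ∀ (s R : ℕ), 3 ≤ L ^ s → M₀ ≤ (L : ℝ) ^ (s + 1) → L ^ (s + 1) ∣ c.ρ → L ^ (s + 1) ∣ c.M → R * L ^ (s + 1) ≤ c.ρ → 2 * L ≤ R →
        R₀ ≤ R → N₀ + 1 ≤ R * L ^ (s + 1) → ρ₀ ≤ (c.ρ : ℝ) →
      -- THE DENT PREMISE ([6] (1.4)₂): `Ω_k` is a union of cubes of side `L^{s+1}Lᵏ` of the grid anchored at `□_k`'s fine lower corner `Lᵏ(c.a − c.ρ)`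
      (∀ x y : Site d,
          blockMap (L ^ (s + 1) * L ^ c.k) (x - fun i => (L : ℤ) ^ c.k * (c.a i - c.ρ) - (ctrShift L c.k : ℤ)) =
            blockMap (L ^ (s + 1) * L ^ c.k) (y - fun i => (L : ℤ) ^ c.k * (c.a i - c.ρ) - (ctrShift L c.k : ℤ)) → x ∈ Ω c.k → y ∈ Ω c.k) →
      ∀ (U₀ : Site d → Fin d → 𝔸ˣ), (∀ x κ, U₀ x κ ∈ unitaryUnits 𝔸) → ∀ (α₀ : ℝ), 0 < α₀ → InAk L K η α₀ Ω U₀ →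
      7 * d * (L : ℝ) ^ 2 * c.M * α₀ ≤ c₁ →
      GaugedBoundB8DZ L η U₀ c (7 * d * (L : ℝ) ^ 2 * (5 * (d : ℝ) * L * B₀) * c.M * α₀) := by
  have hL1 : 1 ≤ L := by omega
  have hL : 2 ≤ L := by omega
  obtain ⟨B₀, ρ₀, M₀, N₀, R₀, hB₀, SC⟩ := sc4_dented_of_ineq159Printed hd2 hLs h159 h159D
  have hB₀pos : 0 < B₀ := lt_of_lt_of_le one_pos hB₀
  have hdr : (2 : ℝ) ≤ d := by exact_mod_cast hd2
  have hLr : (2 : ℝ) ≤ L := by exact_mod_cast hL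
  have hdLr : (5 : ℝ) ≤ (d : ℝ) * L := by exact_mod_cast hdL
  have hB : 2 ≤ 5 * (d : ℝ) * L * B₀ := by nlinarith [hB₀, hdr, hLr]
  have hBd : 4 * B₀ ≤ ((d : ℝ) * L - 1) * B₀ := by nlinarith [hB₀, hdLr]
  obtain ⟨c₁, ρ₁, M₁, N₁, hc₁, P6⟩ := gaugedBoundB8D_dentedMember_scalar_γ_of_real123 (𝔸 := 𝔸) hd2 hLs hs1 hB₀pos hB hB₀pos.le hBd
  refine ⟨B₀, c₁, max ρ₀ ρ₁, max M₀ M₁, max N₀ N₁, R₀, hB₀, hc₁, ?_⟩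
  intro η hη K Ω c s R hMh hM₀ hdρ hdM hRρ h2L hR₀ hN₀ hρ₀ hΩ U₀ hU₀ α₀ hα hA hs
  have hk : 1 ≤ c.k := c.one_le_k
  -- print's side conditions in §1's letters (`M_h := Lˢ`)
  have hMhL : L ^ s * L = L ^ (s + 1) := (pow_succ L s).symm
  have hLMh : L * L ^ s = L ^ (s + 1) := by rw [mul_comm]; exact hMhL
  have hM₁ : M₁ ≤ (L : ℝ) * (L ^ s : ℕ) := by
    have : ((L : ℝ) * (L ^ s : ℕ)) = (L : ℝ) ^ (s + 1) := by push_cast; ring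
    rw [this]; exact (le_max_right _ _).trans hM₀
  have hM₀' : M₀ ≤ (L : ℝ) ^ (s + 1) := (le_max_left _ _).trans hM₀
  have hN₁ : N₁ + 1 ≤ R * (L * L ^ s) := by rw [hLMh]; exact le_trans (Nat.succ_le_succ (le_max_right _ _)) hN₀
  have hN₀' : N₀ + 1 ≤ R * L ^ (s + 1) := le_trans (Nat.succ_le_succ (le_max_left _ _)) hN₀
  have hρ₁ : ρ₁ ≤ (c.ρ : ℝ) := (le_max_right _ _).trans hρ₀
  have hρ₀' : ρ₀ ≤ (c.ρ : ℝ) := (le_max_left _ _).trans hρ₀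
  -- the dent premise in §1's letters (`Lˢ·L^{k+1} = L^{s+1}·Lᵏ`)
  have hpow : L ^ s * L ^ (c.k + 1) = L ^ (s + 1) * L ^ c.k := by ring
  have hΩ' : ∀ x y : Site d, blockMap (L ^ s * L ^ (c.k + 1)) (x - fun i => (L : ℤ) ^ c.k * (c.a i - c.ρ) - (ctrShift L c.k : ℤ)) =
      blockMap (L ^ s * L ^ (c.k + 1)) (y - fun i => (L : ℤ) ^ c.k * (c.a i - c.ρ) - (ctrShift L c.k : ℤ)) → x ∈ Ω c.k → y ∈ Ω c.k := by
    rw [hpow]; exact hΩ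
  -- the SCALAR γ clauses at this datum from the two named facts, in the flat line's split index
  have S := fun m (hm1 : 1 ≤ m) (hmk : m ≤ c.k) =>
    SC η hη c s R hM₀' hdρ hdM hRρ hR₀ hN₀' hρ₀' hΩ m hm1 hmk
      (fun j b => b ∈ c.lamBPT m j ∨ (j = 0 ∧ CrossB (c.sq 0) b)) (lamBPF_sub_splitIndex c hLs hm1 hmk)
  exact P6 η hη c (L ^ s) R hMh hM₁ (by rw [hMhL]; exact hdρ) (by rw [hMhL]; exact hdM) (by rw [hMhL]; exact hRρ) h2L hN₁ hρ₁ hΩ'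
    (fun φ hLan hsupp => S c.k hk le_rfl φ (by rw [show c.lamST c.k = c.lamS from funext (lamST_top_apply c)]; exact hLan) hsupp) U₀ hU₀ α₀ hα hA hs
    (fun m hm1 hmk φ hLan hsupp => ⟨(S m hm1 hmk φ hLan hsupp).1, (S m hm1 hmk φ hLan hsupp).2.1⟩)

/-! ## §3 THE RECORD CROWN: `GaugedBoundB8DZ` at every dented centred member of the sub-lattice, odd `L ≥ 5`, `d ≥ 2` — MODULO THE TWO PRINTED NAMED FACTS OF RECORD -/

open Classical in
/-- ★★★ **PROPOSITION 6 (p. 99), (1.135)–(1.138) AS `Node00.GaugedBoundB8DZ` AT EVERY DENTED CENTRED CUBE MEMBER OF PRINT's BIG-BLOCK SUB-LATTICE, FOR ODD `L = 2s+1 ≥ 5`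
AND `d ≥ 2` — THE RECORD CROWN OF «N05-REC» R6, MODULO EXACTLY TWO PRINTED NAMED FACTS** ([4] Thm 3.3 ∕ [6] (1.59), (1.62) at `U₀ = 1` for the record's linearised averaging
`Q_j(1)` = [4] (3.14)–(3.15), on the pure and on the dented centred cube member: `Ineq159FlatCubeMemberCovPrintedZ d L`, `Ineq159FlatDentedCubeMemberCovPrintedZ d L` — NAMED in
`B8Ineq159FlatCovPrintedRec`, UNPROVED in the tree; every other analytic input — Theorem 4 ∕ Prop. 5 ∕ Sect. E of record, the three REAL families ([4] Thms 3.1–3.2 there), the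
axial ∕ Landau bookkeeping — is a theorem of record): there are `B₀ ≥ 1`, `c₁ > 0` and thresholds `ρ₀, M₀, N₀, R₀` such that for every `η > 0`, every dented RECORD cube datum
`c : CubeB8DZ d L K Ω` ([15] (148)–(150), centred tower) on print's p. 98 sub-lattice above threshold (`M_h = Lˢ ≥ 3`, `M₀ ≤ L^{s+1}`, `L^{s+1} ∣ c.ρ`, `L^{s+1} ∣ c.M`,
`R·L^{s+1} ≤ c.ρ`, `2L ≤ R`, `R₀ ≤ R`, `N₀ + 1 ≤ R·L^{s+1}`, `ρ₀ ≤ c.ρ`) whose ambient top member `Ω_k` is a union of `L^{s+1}Lᵏ`-cubes of the grid anchored at `□_k`'s fine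
lower corner `Lᵏ(c.a − c.ρ) − c_k·𝟙` ((1.4)₂), every unitary `U₀ ∈ 𝔄_K({Ω_j}, α₀)` with `7dL²·c.M·α₀ ≤ c₁` (NO further threshold on `α₀`): `GaugedBoundB8DZ L η U₀ c
(7dL²·(5dLB₀)·c.M·α₀)` — a unitary `u` on `□̃`, `= 1` off `Ω′₀`, (1.29) w.r.t. `{Λ′_j}`, the Landau gauge (1.138) of `U₀″^{u⁻¹}` at background `1` over `{Ω′_j}`, (1.136)₁–₄ with
print's constant shape, `w = v⁻¹u` unitary, (1.135), (1.137).  = §2 with its window `5 ≤ d·L` discharged (`L ≥ 5`, `d ≥ 1`).  The premise the R7 door (dag-n07-w3's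
`BalabanUVNodesN07Thm4RecMember*`) consumes, in its quantifier shape.
[cite: Balaban1985RegularSpaces, Prop. 6 (1.135)–(1.138) p.99, p.98, (1.59) p.86, (1.62) p.87, (1.91)–(1.92) p.91, (1.98) p.92, (1.101) p.93, (1.4) p.77; Balaban1985Variational, (148)–(153) p.301, p.300; Balaban1985BackgroundPropagators, (3.14)–(3.15) p.393, Thms 3.1–3.3 pp.398–399; Balaban1984PropagatorsII, Prop. 2.6 (2.136) p.247, Prop. 2.3 (2.87) p.238; Balaban1987RG1, (0.3)–(0.4) pp.252–253] -/
theorem gaugedBoundB8DZ_dentedMember_of_cov159 (hd2 : 2 ≤ d) {L sL : ℕ} (hLs : L = 2 * sL + 1) (hs2 : 2 ≤ sL)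
    (h159 : Ineq159FlatCubeMemberCovPrintedZ d L) (h159D : Ineq159FlatDentedCubeMemberCovPrintedZ d L) :
    ∃ B₀ c₁ ρ₀ M₀ : ℝ, ∃ N₀ R₀ : ℕ, 1 ≤ B₀ ∧ 0 < c₁ ∧ ∀ (η : ℝ), 0 < η → ∀ {K : ℕ} {Ω : ℕ → Set (Site d)} (c : CubeB8DZ d L K Ω),
      -- PRINT'S SIDE CONDITIONS (p. 98) on the cube datum in the named facts' letters (`M_h = Lˢ`), above threshold
      ∀ (s R : ℕ), 3 ≤ L ^ s → M₀ ≤ (L : ℝ) ^ (s + 1) → L ^ (s + 1) ∣ c.ρ → L ^ (s + 1) ∣ c.M → R * L ^ (s + 1) ≤ c.ρ → 2 * L ≤ R →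
        R₀ ≤ R → N₀ + 1 ≤ R * L ^ (s + 1) → ρ₀ ≤ (c.ρ : ℝ) →
      -- THE DENT PREMISE ([6] (1.4)₂): `Ω_k` is a union of cubes of side `L^{s+1}Lᵏ` of the grid anchored at `□_k`'s fine lower corner `Lᵏ(c.a − c.ρ)`
      (∀ x y : Site d,
          blockMap (L ^ (s + 1) * L ^ c.k) (x - fun i => (L : ℤ) ^ c.k * (c.a i - c.ρ) - (ctrShift L c.k : ℤ)) =
            blockMap (L ^ (s + 1) * L ^ c.k) (y - fun i => (L : ℤ) ^ c.k * (c.a i - c.ρ) - (ctrShift L c.k : ℤ)) → x ∈ Ω c.k → y ∈ Ω c.k) →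
      ∀ (U₀ : Site d → Fin d → 𝔸ˣ), (∀ x κ, U₀ x κ ∈ unitaryUnits 𝔸) → ∀ (α₀ : ℝ), 0 < α₀ → InAk L K η α₀ Ω U₀ →
      7 * d * (L : ℝ) ^ 2 * c.M * α₀ ≤ c₁ →
      GaugedBoundB8DZ L η U₀ c (7 * d * (L : ℝ) ^ 2 * (5 * (d : ℝ) * L * B₀) * c.M * α₀) := by
  have hL5 : 5 ≤ L := by omega
  have hd1 : 0 < d := by omega
  exact gaugedBoundB8D_dentedMember_scalar_γ_of_namedFacts (𝔸 := 𝔸) hd2 hLs (by omega) (le_trans hL5 (Nat.le_mul_of_pos_left L hd1)) h159 h159D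

end Literature.MathematicalPhysics.QuantumFieldTheory.Balaban1983to89.B8Prop6DentedCubeMemberScalarGammaOfNamedFactsRec

end
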